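import Mathlib
import Summits.ValiantsHypothesis.ValiantsHypothesis.Theorems.NewtonTauWeak.Negative.Zonogon
import Summits.ValiantsHypothesis.ValiantsHypothesis.Theorems.NewtonUnitEquationsTwoProductsReduction

/-!
# `NewtonTauWeak` (stmt-ValiantsHypothesis-5904), line `binomial-normal-form`: the open stub holds for `K ≤ 2`

Support file for the crux
`Summit.ValiantsHypothesis.ValiantsHypothesis.Theses.NewtonUnitEquations.NewtonTauWeak`
(KPTT arXiv:1308.2286, Conjecture 1 in the weak form of their Theorem 1).

The line `binomial-normal-form` is closed modulo ONE registered stub, `stub_binomialNewtonTauCommon`: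
`∃ b, ∀ K N c ρ d, vert(Σ_{l<K} c_l Π_{j<N} (1 - ρ_{lj} X^{d_j})) ≤ (K N+2)^b` — KPTT's Conjecture 1 at
sparsity `t = 2` in polynomial form (a rank-`≤ K` tensor on the `N`-cube pushed forward along the subset-sum
map `J ↦ Σ_{j∈J} d_j`, coincidences among subset sums ALLOWED).  This file records, against that exact
statement, the largest number of products for which it is a THEOREM of the tree: every instance with
`K ≤ 2` products satisfies `vert ≤ 72 (N+2)^2`, uniformly in the exponent list `d` (coinciding subset sums,
zero coefficients `ρ_{lj} = 0` and arbitrary scalars `c_l` included).  It is the `t = 2` case of the sibling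
crux `TwoProducts` (stmt-ValiantsHypothesis-5906), PROVED in
`Theorems/NewtonUnitEquationsTwoProductsReduction.lean` (`twoProducts_sparsity_le_two`: two products of
`m` factors with `≤ 2` monomials each have `≤ 72 (m+1)^2` Newton vertices): a sum of `K ≤ 2` scalar multiples
of products of `N` binomials is `Π_{j ≤ N} f_j - Π_{j ≤ N} g_j` with the `2`-sparse factors
`f_0 = C c_0`, `f_{j+1} = 1 - ρ_{0j} X^{d_j}`, `g_0 = C(-c_1)`, `g_{j+1} = 1 - ρ_{1j} X^{d_j}` (for `K = 1` take
`g_0 = 0`; for `K = 0` the sum is `0`).  So the open layer of the stub begins at `K = 3`.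

Main result: `stub_binomialNewtonTauCommon_le_two`.  Helper lemmas live in the sub-namespace
`BinomialCommonTwo`; nothing here is a definition or a named fact.

References: P. Koiran, N. Portier, S. Tavenas, S. Thomassé, *A τ-conjecture for Newton polygons*,
arXiv:1308.2286 (FoCM 15 (2015)), Conjecture 1 and §5; the reduction to `TwoProducts` is bookkeeping [folklore].
-/

-- the namespace mandated for this Theorems file repeats the component `ValiantsHypothesis`
set_option linter.dupNamespace false

noncomputable section

open scoped BigOperators
open MvPolynomial
open Summit.ValiantsHypothesis.ValiantsHypothesis.Theorems.NewtonTauWeak.Negative (vert)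

namespace Summit.ValiantsHypothesis.ValiantsHypothesis.Theorems.NewtonUnitEquationsNewtonTauWeak

namespace BinomialCommonTwo

/-- A constant has at most one monomial, so at most `2`. [folklore] -/
theorem card_support_C_le_two (a : ℂ) : (C a : MvPolynomial (Fin 2) ℂ).support.card ≤ 2 := by
  rw [C_apply]
  exact (Finset.card_le_card support_monomial_subset).trans (by simp)

/-- A binomial `1 - C ρ · X^d` has at most `2` monomials. [folklore] -/
theorem card_support_binomial_le_two (ρ : ℂ) (d : Fin 2 →₀ ℕ) :
    (1 - C ρ * monomial d (1 : ℂ) : MvPolynomial (Fin 2) ℂ).support.card ≤ 2 :=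
  calc (1 - C ρ * monomial d (1 : ℂ)).support.card
      ≤ ((1 : MvPolynomial (Fin 2) ℂ).support ∪ (C ρ * monomial d (1 : ℂ)).support).card :=
        Finset.card_le_card (support_sub ..)
    _ ≤ (1 : MvPolynomial (Fin 2) ℂ).support.card + (C ρ * monomial d (1 : ℂ)).support.card :=
        Finset.card_union_le _ _
    _ ≤ 1 + 1 := by
        gcongr
        · rw [support_one]; simp
        · rw [C_mul_monomial]
          exact (Finset.card_le_card support_monomial_subset).trans (by simp)

/-- The `2`-sparse factor list `(C a, 1 - ρ_0 X^{d_0}, …, 1 - ρ_{N-1} X^{d_{N-1}})` of length `N + 1`. -/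
theorem card_support_cons_le_two {N : ℕ} (a : ℂ) (ρ : Fin N → ℂ) (d : Fin N → (Fin 2 →₀ ℕ))
    (j : Fin (N + 1)) :
    ((Fin.cons (C a) (fun j => 1 - C (ρ j) * monomial (d j) 1) :
        Fin (N + 1) → MvPolynomial (Fin 2) ℂ) j).support.card ≤ 2 := by
  refine Fin.cases ?_ (fun j => ?_) j
  · simp only [Fin.cons_zero]
    exact card_support_C_le_two a
  · simp only [Fin.cons_succ]
    exact card_support_binomial_le_two (ρ j) (d j)

/-- The product of that factor list is the scalar multiple of the product of the binomials. [folklore] -/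
theorem prod_cons {N : ℕ} (a : ℂ) (ρ : Fin N → ℂ) (d : Fin N → (Fin 2 →₀ ℕ)) :
    (∏ j, (Fin.cons (C a) (fun j => 1 - C (ρ j) * monomial (d j) 1) :
        Fin (N + 1) → MvPolynomial (Fin 2) ℂ) j) = C a * ∏ j, (1 - C (ρ j) * monomial (d j) 1) := by
  rw [Fin.prod_univ_succ]
  simp only [Fin.cons_zero, Fin.cons_succ]

/-- TWO scalar multiples of products of binomials over a common exponent list: `≤ 72 (N+2)^2` Newton vertices
(the `t = 2` case of `TwoProducts`, `twoProducts_sparsity_le_two`, applied to factor lists of length `N + 1`).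
[folklore] -/
theorem vert_two_le (N : ℕ) (c₀ c₁ : ℂ) (ρ₀ ρ₁ : Fin N → ℂ) (d : Fin N → (Fin 2 →₀ ℕ)) :
    vert (C c₀ * ∏ j, (1 - C (ρ₀ j) * monomial (d j) 1) + C c₁ * ∏ j, (1 - C (ρ₁ j) * monomial (d j) 1)) ≤
      72 * (N + 2) ^ 2 := by
  have h := Summit.ValiantsHypothesis.ValiantsHypothesis.Theorems.TwoProducts.Reduction.twoProducts_sparsity_le_two
    (N + 1) 2 (Fin.cons (C c₀) (fun j => 1 - C (ρ₀ j) * monomial (d j) 1))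
    (Fin.cons (C (-c₁)) (fun j => 1 - C (ρ₁ j) * monomial (d j) 1)) le_rfl
    (card_support_cons_le_two c₀ ρ₀ d) (card_support_cons_le_two (-c₁) ρ₁ d)
  rw [prod_cons, prod_cons, map_neg, neg_mul, sub_neg_eq_add] at h
  exact h

end BinomialCommonTwo

/-- **The open stub `stub_binomialNewtonTauCommon` of line `binomial-normal-form` holds for `K ≤ 2` products**
(with the explicit bound `72 (N+2)^2`, for every exponent list `d`, coincidences among subset sums and zero
coefficients allowed): a sum of at most two scalar multiples of products of `N` binomials `1 - ρ_{lj} X^{d_j}` is a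
difference of two products of `N + 1` factors with at most `2` monomials each, to which the PROVED `t = 2` case of
the sibling crux `TwoProducts` (`twoProducts_sparsity_le_two`) applies; `K = 0` is the zero polynomial and
`K = 1` pairs the product with the zero product.  Hence the first open layer of the stub is `K = 3`.
[folklore; KPTT arXiv:1308.2286 Conj. 1 at `t = 2`] -/
theorem stub_binomialNewtonTauCommon_le_two (K N : ℕ) (hK : K ≤ 2) (c : Fin K → ℂ) (ρ : Fin K → Fin N → ℂ)
    (d : Fin N → (Fin 2 →₀ ℕ)) :
    vert (∑ l, C (c l) * ∏ j, (1 - C (ρ l j) * monomial (d j) 1)) ≤ 72 * (N + 2) ^ 2 := by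
  interval_cases K
  · -- no product: the zero polynomial
    simp [vert]
  · -- one product: pair it with the zero multiple of itself
    have h := BinomialCommonTwo.vert_two_le N (c 0) 0 (ρ 0) (ρ 0) d
    rw [C_0, zero_mul, add_zero] at h
    rw [Fin.sum_univ_one]
    exact h
  · rw [Fin.sum_univ_two]
    exact BinomialCommonTwo.vert_two_le N (c 0) (c 1) (ρ 0) (ρ 1) d

end Summit.ValiantsHypothesis.ValiantsHypothesis.Theorems.NewtonUnitEquationsNewtonTauWeak

end
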